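import Mathlib.NumberTheory.Padics.RingHoms
import Mathlib.Topology.Algebra.Valued.NormedValued
import Literature.NumberTheory.EllipticCurves.PointReduction
import Literature.NumberTheory.EllipticCurves.VariableChangePoints
import HarnessLib

/-!
# Mazur (1977), Ch. III §5, Step 2: a rational point of prime order `N ≥ 11` forces bad reduction at `2` and `3`

`Proofs` file (theorems only; no definitions, no named facts) attached to the named fact
`Literature.NumberTheory.EllipticCurves.Mazur1977_no_prime_torsion` of `MazurTorsion.lean`
(B. Mazur, *Modular curves and the Eisenstein ideal*, Publ. Math. IHÉS 47 (1977), Ch. III §5,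
pp. 156–160: no elliptic curve over `ℚ` has a rational point of prime order
`N ∉ {2, 3, 5, 7, 13}`). That proof ("For the duration of the proof, let, then, `N` denote a
prime number `≠ 2, 3, 5, 7` or `13`, and let `ℤ/N ⊂ E` be an elliptic curve over `ℚ` with a
point of order `N`", p. 157) proceeds, after three reductions, in four steps analysing the
putative `ℤ/N ⊂ E`; almost all of it (Néron models, Raynaud's theorem, the Eisenstein quotient)
is far from Mathlib. Its **Step 2** (p. 158: "If `q = 2`, or `3`, then `E` has bad (hence
multiplicative) reduction at `q`, and the specialization `ℤ/N_{/𝔽_q}` is not contained in the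
connected component of the identity `(E_{/𝔽_q})⁰`"), however, begins with an elementary
sentence (p. 159): "If `E_{/𝔽_q}` were an elliptic curve, and `ℤ/N ⊂ E_{/𝔽_q}`, then by the
'Riemann hypothesis' `N < 1 + q + 2√q`, which is impossible for `q = 2, 3`. Therefore, `E` has
bad reduction at `q` (`= 2, 3`)". This file PROVES that sentence, for every Weierstrass model,
with the Riemann hypothesis for curves over finite fields (not in Mathlib) replaced by the
trivial count `#Ẽ(𝔽_q) ≤ q² + 1` — which for `q ≤ 3` is `≤ 10 < 11 ≤ N` and therefore serves
equally well:

* `addOrderOf_le_card_sq_add_one_of_val_Δ_eq_one` — over any valued field `(L, w)` with a residue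
  map `r : 𝒪_w → k` onto a **finite** field `k` (`ker r = 𝔪_w`): on a `w`-integral Weierstrass
  equation with `w(Δ) = 1` (good reduction), a point `P` killed by an integer `n` with `w(n) = 1`
  has order `≤ #k² + 1`. (The prime-to-`p` torsion injects into `Ẽ(k)` — Silverman, *AEC*,
  Prop. VII.3.1(b), the tree's `injective_reduceHom`, file `PointReduction` — and `Ẽ(k)` has at
  most `#k² + 1` points.)
* `exists_residueMap` — the residue map `ℤ_(ℓ) → ℤ_ℓ → 𝔽_ℓ` for the `ℓ`-adic absolute value
  `q ↦ ‖q‖_ℓ` of `ℚ` (as in `KubertTwoTwelveProofs.exists_reduceHom`, isolated).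
* **`val_Δ_lt_one_of_addOrderOf_eq_prime`** — for a prime `ℓ` and an `ℓ`-integral Weierstrass
  equation `V` over `ℚ` carrying a rational point of prime order `N > ℓ² + 1`: `‖Δ(V)‖_ℓ < 1`,
  i.e. `ℓ ∣ Δ(V)` — the equation has singular reduction modulo `ℓ`.
* **`Mazur1977_stepTwo_bad_reduction`** — the printed assertion: if an elliptic curve (indeed
  any Weierstrass cubic) `W/ℚ` has a rational point of prime order `N ≥ 11`, then for
  `ℓ ∈ {2, 3}` EVERY `ℓ`-integral Weierstrass equation `C • W` of `W` (`C` an admissible change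
  of variables over `ℚ`) has `‖Δ(C • W)‖_ℓ < 1`: `W` has no model with good reduction at `2` or
  at `3`, i.e. "`E` has bad reduction at `q = 2, 3`". (Orders are transported along `C` by the
  tree's `VariableChange.pointEquiv`, Silverman *AEC* III.3.1(b).)

The second half of Step 2 (multiplicative type by Step 1, and `ℤ/N ⊄ (E_{/𝔽_q})⁰` by Tate's
`(E_{/𝔽_{q²}})⁰ ≅ 𝔾_m` with `q² - 1` points) needs Néron models / the Tate curve and is not
treated.

## References

* [Mazur1977] B. Mazur, *Modular curves and the Eisenstein ideal*, Publ. Math. IHÉS 47 (1977)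
  33–186: Ch. III §5, p. 157 (the standing hypothesis `ℤ/N ⊂ E`), p. 158 (statement of Step 2),
  p. 159 (its proof, first two sentences). Held: `paper:doi-10-1007-bf02684339`, PDF pp. 126–128.
* [SilvermanAEC2009] J. H. Silverman, *The Arithmetic of Elliptic Curves*, 2nd ed., GTM 106:
  Prop. VII.3.1(b) (torsion injects into the reduction), VII.§2 (reduction modulo `π`),
  Prop. III.3.1(b) (changes of variables), Thm. V.1.1 (Hasse; replaced here by the trivial bound).

## Design

* Theorems only. The general statement is in the valuation-theoretic setting of
  `PointReduction.lean` (`open scoped Classical`, value group `ℝ≥0`, integrality through Mathlib's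
  `WeierstrassCurve.IsIntegral w.integer`); the `ℓ`-adic absolute value of `ℚ` is written
  `(NormedField.valuation.comap (Rat.castHom ℚ_[ℓ]) : Valuation ℚ ℝ≥0)` as in
  `KubertTwoTwelveProofs.lean`.
* The statements over `ℚ` are polymorphic in the `DecidableEq ℚ` instance carrying the group law
  (explicit instance binder, substituted inside the proof for the classical instance of
  `PointReduction.lean` by `Subsingleton.elim`), so that they apply verbatim to the torsion points
  of `MazurTorsion.lean`.
-/

noncomputable section

open scoped Classical NNReal
open WeierstrassCurve

universe u v

namespace Literature.NumberTheory.EllipticCurves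

/-! ### The trivial count of points over a finite ring -/

/-- Over a finite ring `k`, the points of a Weierstrass cubic inject into `Option (k × k)`
(`𝒪 ↦ none`, `(x, y) ↦ (x, y)`); hence they form a finite set with at most `#k² + 1` elements.
(The tree's `WeierstrassCurve.natCard_point_le`, file `AnalyticRankProofs`, restated to keep the
analytic imports out of this arithmetic file.) [folklore] -/
private theorem finite_point_and_natCard_le {k : Type*} [CommRing k] [Finite k]
    (V : WeierstrassCurve k) :
    Finite V.toAffine.Point ∧ Nat.card V.toAffine.Point ≤ Nat.card k ^ 2 + 1 := by
  let e : V.toAffine.Point → Option (k × k) := fun P ↦ match P with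
    | .zero => none
    | .some x y _ => some (x, y)
  have he : Function.Injective e := by
    rintro (_ | ⟨x, y, h⟩) (_ | ⟨x', y', h'⟩) hh
    · rfl
    · simp [e] at hh
    · simp [e] at hh
    · simp only [e, Option.some.injEq, Prod.mk.injEq] at hh
      obtain ⟨rfl, rfl⟩ := hh
      rfl
  refine ⟨Finite.of_injective e he, ?_⟩
  calc Nat.card _ ≤ Nat.card (Option (k × k)) := Nat.card_le_card_of_injective e he
    _ = _ := by rw [Finite.card_option, Nat.card_prod, sq]

/-! ### Good reduction bounds the prime-to-`p` torsion by `#Ẽ(k) ≤ #k² + 1` -/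

/-- **Prime-to-`p` torsion under good reduction is bounded by the reduction** (Silverman, *AEC*,
Prop. VII.3.1(b), combined with the trivial count of `Ẽ(k)`): let `(L, w)` be a valued field,
`r : 𝒪_w → k` a ring homomorphism onto a finite field with `ker r = 𝔪_w`, `V` a `w`-integral
Weierstrass equation with `w(Δ) = 1`. If `n • P = 𝒪` for an integer `n` with `w(n) = 1`, then
`P` has order at most `#k² + 1`. Proof: `P` lies in the prime-to-`𝔪_w` torsion, which the
reduction homomorphism embeds into `Ṽ(k)` (`injective_reduceHom`); an injective homomorphism
preserves orders, and the order of an element of the finite group `Ṽ(k)` is at most its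
cardinality `≤ #k² + 1`. (Mazur, p. 159, uses Hasse's `#Ẽ(𝔽_q) ≤ 1 + q + 2√q` at this point.)
[cite: SilvermanAEC2009, Prop. VII.3.1(b); Mazur1977, Ch. III §5, Step 2, p. 159] -/
theorem addOrderOf_le_card_sq_add_one_of_val_Δ_eq_one
    {L : Type u} [Field L] {w : Valuation L ℝ≥0} {k : Type v} [Field k] [Finite k]
    (r : w.integer →+* k) (hr : ∀ a : w.integer, r a = 0 ↔ w (a : L) < 1)
    {V : WeierstrassCurve L} [V.IsIntegral w.integer] (hΔ : w V.Δ = 1)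
    {P : V.toAffine.Point} {n : ℤ} (hn : w n = 1) (hP : n • P = 0) :
    addOrderOf P ≤ Nat.card k ^ 2 + 1 := by
  have hmem : P ∈ goodTorsion w V := mem_goodTorsion_of_zsmul_eq_zero hn hP
  have hf := injective_reduceHom hr hΔ (rfl : reduceCurve r V = reduceCurve r V)
  obtain ⟨hfin, hcard⟩ := finite_point_and_natCard_le (reduceCurve r V)
  haveI := hfin
  haveI : Fintype (reduceCurve r V).toAffine.Point := Fintype.ofFinite _
  calc addOrderOf P
      = addOrderOf ((goodTorsion w V).subtype ⟨P, hmem⟩) := rfl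
    _ = addOrderOf (⟨P, hmem⟩ : goodTorsion w V) :=
        addOrderOf_injective _ Subtype.coe_injective _
    _ = addOrderOf (reduceHom w r hr hΔ rfl ⟨P, hmem⟩) := (addOrderOf_injective _ hf _).symm
    _ ≤ Fintype.card (reduceCurve r V).toAffine.Point := addOrderOf_le_card_univ
    _ = Nat.card (reduceCurve r V).toAffine.Point := Nat.card_eq_fintype_card.symm
    _ ≤ Nat.card k ^ 2 + 1 := hcard

/-! ### Over `ℚ`: the `ℓ`-adic absolute value and its residue map -/

section Rat

-- The `ℓ`-adic absolute value of `ℚ` is written throughout as the valuation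
-- `(NormedField.valuation.comap (Rat.castHom ℚ_[ℓ]) : Valuation ℚ ℝ≥0)`, `q ↦ ‖q‖_ℓ` pulled back
-- from `ℚ_ℓ` (the tree's `ratAdicValuation` of `CanonicalPAdicHeightParallelogramProofs.lean`, and
-- the valuation of `KubertTwoTwelveProofs.lean`; no notation is introduced).

variable (ℓ : ℕ) [Fact ℓ.Prime]

/-- **The residue map of the `ℓ`-adic valuation of `ℚ`**: for the `ℓ`-adic absolute value
`w(q) = ‖q‖_ℓ` (pulled back from `ℚ_ℓ`), the composite `𝒪_w = ℤ_(ℓ) → ℤ_ℓ → ℤ/ℓℤ` (Mathlib's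
`PadicInt.toZMod`) is a ring homomorphism with kernel `𝔪_w = {w < 1}`. (The construction inside
`KubertTwoTwelveProofs.exists_reduceHom`, isolated.) [folklore] -/
theorem exists_residueMap :
    ∃ r : (NormedField.valuation.comap (Rat.castHom ℚ_[ℓ]) : Valuation ℚ ℝ≥0).integer →+* ZMod ℓ,
      ∀ a, r a = 0 ↔
        (NormedField.valuation.comap (Rat.castHom ℚ_[ℓ]) : Valuation ℚ ℝ≥0) (a : ℚ) < 1 := by
  set w : Valuation ℚ ℝ≥0 := NormedField.valuation.comap (Rat.castHom ℚ_[ℓ]) with hw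
  have hw1 : ∀ q : ℚ, w q ≤ 1 ↔ ‖(q : ℚ_[ℓ])‖ ≤ 1 := fun q => by
    rw [hw, Valuation.comap_apply, ← NNReal.coe_le_coe, NNReal.coe_one]; rfl
  have hw1' : ∀ q : ℚ, w q < 1 ↔ ‖(q : ℚ_[ℓ])‖ < 1 := fun q => by
    rw [hw, Valuation.comap_apply, ← NNReal.coe_lt_coe, NNReal.coe_one]; rfl
  let ι : w.integer →+* ℤ_[ℓ] :=
    { toFun := fun a => ⟨((a : ℚ) : ℚ_[ℓ]), (hw1 a).mp a.2⟩
      map_one' := Subtype.ext (by simp)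
      map_mul' := fun a b => Subtype.ext (by simp)
      map_zero' := Subtype.ext (by simp)
      map_add' := fun a b => Subtype.ext (by simp) }
  refine ⟨PadicInt.toZMod.comp ι, fun a => ?_⟩
  rw [hw1', RingHom.comp_apply, ← RingHom.mem_ker, PadicInt.ker_toZMod,
    IsLocalRing.mem_maximalIdeal, PadicInt.mem_nonunits, PadicInt.norm_def]
  rfl

/-- `‖N‖_ℓ = 1` for a natural number `N` prime to `ℓ`. [folklore] -/
private theorem ratAdic_val_natCast_eq_one {N : ℕ} (hN : ℓ.Coprime N) :
    (NormedField.valuation.comap (Rat.castHom ℚ_[ℓ]) : Valuation ℚ ℝ≥0) ((N : ℤ) : ℚ) = 1 := by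
  rw [Valuation.comap_apply, map_intCast, Int.cast_natCast, ← NNReal.coe_eq_one]
  exact Padic.norm_natCast_eq_one_iff.mpr hN

/-- `‖Δ‖_ℓ ≤ 1` on an `ℓ`-integral equation. [folklore] -/
private theorem ratAdic_val_Δ_le_one (V : WeierstrassCurve ℚ)
    [hV : V.IsIntegral
      (NormedField.valuation.comap (Rat.castHom ℚ_[ℓ]) : Valuation ℚ ℝ≥0).integer] :
    (NormedField.valuation.comap (Rat.castHom ℚ_[ℓ]) : Valuation ℚ ℝ≥0) V.Δ ≤ 1 := by
  obtain ⟨M, hM⟩ := hV.integral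
  rw [hM, WeierstrassCurve.baseChange, map_Δ]
  exact (M.Δ).2

/-- **An `ℓ`-integral equation over `ℚ` with a rational point of prime order `N > ℓ² + 1` has
`ℓ ∣ Δ`** (Mazur 1977, Ch. III §5, Step 2, first assertion, p. 159: "If `E_{/𝔽_q}` were an
elliptic curve, and `ℤ/N ⊂ E_{/𝔽_q}`, then … `N < 1 + q + 2√q`, which is impossible for
`q = 2, 3`. Therefore, `E` has bad reduction at `q`"; here with the trivial bound `q² + 1` in
place of Hasse's, for an arbitrary prime `q = ℓ` with `ℓ² + 1 < N`). For a prime `ℓ`, a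
Weierstrass equation `V` over `ℚ` with `ℓ`-integral coefficients, and a point `P ∈ V(ℚ)` of
prime order `N` with `ℓ² + 1 < N`: `‖Δ(V)‖_ℓ < 1`. Proof: `Δ` is `ℓ`-integral; if `‖Δ‖_ℓ = 1`
then, as `ℓ ∤ N` (`N > ℓ`), `‖N‖_ℓ = 1` and `addOrderOf_le_card_sq_add_one_of_val_Δ_eq_one`
with the residue map onto `𝔽_ℓ` (`#𝔽_ℓ = ℓ`) gives `N ≤ ℓ² + 1`. Polymorphic in the
`DecidableEq ℚ` instance of the group law (substituted for the classical one of
`PointReduction.lean` inside the proof). [cite: Mazur1977, Ch. III §5, Step 2, pp. 158–159; SilvermanAEC2009, Prop. VII.3.1(b)] -/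
theorem val_Δ_lt_one_of_addOrderOf_eq_prime [inst : DecidableEq ℚ] (V : WeierstrassCurve ℚ)
    [V.IsIntegral
      (NormedField.valuation.comap (Rat.castHom ℚ_[ℓ]) : Valuation ℚ ℝ≥0).integer]
    {N : ℕ} (hN : N.Prime) (hℓN : ℓ ^ 2 + 1 < N) {P : V.toAffine.Point}
    (hP : addOrderOf P = N) :
    (NormedField.valuation.comap (Rat.castHom ℚ_[ℓ]) : Valuation ℚ ℝ≥0) V.Δ < 1 := by
  obtain rfl : inst = Classical.decEq ℚ := Subsingleton.elim _ _
  letI : DecidableEq ℚ := Classical.decEq ℚ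
  rcases (ratAdic_val_Δ_le_one ℓ V).lt_or_eq with hlt | hΔ
  · exact hlt
  exfalso
  have hℓ : ℓ.Prime := Fact.out
  have hℓltN : ℓ < N :=
    lt_of_le_of_lt (Nat.le_self_pow two_ne_zero ℓ) (lt_of_le_of_lt (Nat.le_succ _) hℓN)
  have hcop : ℓ.Coprime N := (Nat.coprime_primes hℓ hN).mpr (Nat.ne_of_lt hℓltN)
  have hn := ratAdic_val_natCast_eq_one ℓ hcop
  have hPN : (N : ℤ) • P = 0 := by
    rw [natCast_zsmul, ← hP]
    exact addOrderOf_nsmul_eq_zero P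
  obtain ⟨r, hr⟩ := exists_residueMap ℓ
  have hle := addOrderOf_le_card_sq_add_one_of_val_Δ_eq_one r hr hΔ hn hPN
  rw [hP, Nat.card_zmod] at hle
  exact absurd hℓN (not_lt.mpr hle)

/-- **Mazur 1977, Ch. III §5, Step 2 (first assertion): bad reduction at `2` and `3`.** Let
`W` be a Weierstrass cubic over `ℚ` (e.g. an elliptic curve) with a rational point of prime
order `N ≥ 11`, and let `ℓ = 2` or `ℓ = 3`. Then every `ℓ`-integral Weierstrass equation
`C • W` of `W` — `C` any admissible change of variables over `ℚ` making the coefficients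
`ℓ`-integral, in particular any minimal model at `ℓ` — has `‖Δ(C • W)‖_ℓ < 1`: no model of `W`
has good reduction at `ℓ`, "`E` has bad reduction at `q` (`= 2, 3`)" (Mazur, p. 159, where
the bound is Hasse's `N < 1 + q + 2√q`; here `N ≤ q² + 1 ≤ 10`). Proof: the group isomorphism
`W(ℚ) ≃+ (C • W)(ℚ)` of the change of variables (`VariableChange.pointEquiv`, *AEC* III.3.1(b))
carries the point to one of the same order on `C • W`, and
`val_Δ_lt_one_of_addOrderOf_eq_prime` applies since `ℓ² + 1 ≤ 10 < 11 ≤ N`. Polymorphic in the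
`DecidableEq ℚ` instance. [cite: Mazur1977, Ch. III §5, Step 2, pp. 158–159 (first assertion: bad reduction at q = 2, 3)] -/
theorem Mazur1977_stepTwo_bad_reduction [DecidableEq ℚ] (hℓ : ℓ = 2 ∨ ℓ = 3)
    (W : WeierstrassCurve ℚ) {N : ℕ} (hN : N.Prime) (h11 : 11 ≤ N)
    (hex : ∃ P : W.toAffine.Point, addOrderOf P = N) (C : VariableChange ℚ)
    [(C • W).IsIntegral
      (NormedField.valuation.comap (Rat.castHom ℚ_[ℓ]) : Valuation ℚ ℝ≥0).integer] :
    (NormedField.valuation.comap (Rat.castHom ℚ_[ℓ]) : Valuation ℚ ℝ≥0) (C • W).Δ < 1 := by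
  obtain ⟨P, hP⟩ := hex
  have h10 : ℓ ^ 2 + 1 ≤ 10 := by
    rcases hℓ with rfl | rfl <;> norm_num
  have hℓN : ℓ ^ 2 + 1 < N := lt_of_le_of_lt h10 (by omega)
  refine val_Δ_lt_one_of_addOrderOf_eq_prime ℓ (C • W) hN hℓN
    (P := VariableChange.pointEquiv W C P) ?_
  rw [AddEquiv.addOrderOf_eq, hP]

end Rat

end Literature.NumberTheory.EllipticCurves

end
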